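import Mathlib
import Summits.MatrixMultiplication.MatrixMultiplication.Theorems.SoloBlindFlatConjecture

/-!
# Solo-blind (K₃) programme — the rank lemma behind the finite all-rank criterion for Conjecture K♭

Conjecture K♭ (`soloBlindKFlatAt`, file `SoloBlindFlatConjecture`) bounds the Kraft mass of a target by
`1 + 2^{-ρ} - 2^{ρ-c}`, where `ρ` is the rank of the span of the core and `c` its size.  The reduction of
K♭ at fixed corank to a finite check rests on one piece of linear algebra, proved here in general:

**Rank lemma.**  Let `W ≤ G` be a finite-dimensional subspace, `y : κ → G` finitely many vectors
("letters") and `P` a family of subsets of `κ` containing `C₀` such that all the differences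
`∑_{x ∈ C} y x - ∑_{x ∈ C₀} y x` (`C ∈ P`) lie in `W`.  Let `D ≤ (κ → K)` be the span of the indicator
differences `1_C - 1_{C₀}`, `C ∈ P`.  Then
`finrank (W ⊔ span (range y)) + finrank D ≤ finrank W + |κ|`
(`soloBlind_finrank_sup_span_add_le`).  In the application `W` is spanned by the visible block elements of
the core, `y` lists the letters, and `P` is the exact presence family of the target: every representation
difference is a sum of block elements, so the rank of the core is at most
`(number of visible block elements) + (number of letters) - dim D`.

Proof: the linear combination map `Φ : (κ → K) → G`, `v ↦ ∑ v x • y x`, sends `D` into `W`; choosing a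
complement `E` of `D`, `span (range y) = Φ(D ⊔ E) ≤ W ⊔ Φ(E)`, and `dim Φ(E) ≤ dim E = |κ| - dim D`.
-/

namespace Summit.MatrixMultiplication.MatrixMultiplication.Theorems

open Module

variable {K : Type*} [Field K] {G : Type*} [AddCommGroup G] [Module K G]
variable {κ : Type*} [Fintype κ] [DecidableEq κ]

/-- The difference space `D(P, C₀) = span {1_C - 1_{C₀} : C ∈ P} ≤ (κ → K)` of a family `P` of finite
subsets of `κ` relative to a base set `C₀` (indicator vectors `1_C = Set.indicator C 1`). -/
def soloBlindDiffSpace (K : Type*) [Field K] (P : Finset (Finset κ)) (C₀ : Finset κ) :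
    Submodule K (κ → K) :=
  Submodule.span K
    ((fun C : Finset κ => (C : Set κ).indicator (1 : κ → K) - (C₀ : Set κ).indicator 1) '' (P : Set (Finset κ)))

/-- The linear-combination map evaluates an indicator vector to the corresponding subset sum. -/
theorem soloBlind_linearCombination_indicator (y : κ → G) (C : Finset κ) :
    Fintype.linearCombination K y ((C : Set κ).indicator (1 : κ → K)) = ∑ x ∈ C, y x := by
  rw [Fintype.linearCombination_apply]
  simp only [Set.indicator_apply, Finset.mem_coe, Pi.one_apply, ite_smul, one_smul, zero_smul]
  rw [Finset.sum_ite_mem, Finset.univ_inter]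

/-- The difference space is mapped into `W` by the linear-combination map as soon as every
representation difference `∑_{C} y - ∑_{C₀} y` (`C ∈ P`) lies in `W`. -/
theorem soloBlind_diffSpace_le_comap (W : Submodule K G) (y : κ → G)
    (P : Finset (Finset κ)) (C₀ : Finset κ)
    (hP : ∀ C ∈ P, ∑ x ∈ C, y x - ∑ x ∈ C₀, y x ∈ W) :
    soloBlindDiffSpace K P C₀ ≤ W.comap (Fintype.linearCombination K y) := by
  unfold soloBlindDiffSpace
  rw [Submodule.span_le]
  rintro v ⟨C, hC, rfl⟩
  simp only [SetLike.mem_coe, Submodule.mem_comap, map_sub, soloBlind_linearCombination_indicator]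
  exact hP C hC

/-- **Rank lemma** (abstract form): `finrank (W ⊔ span (range y)) + finrank D ≤ finrank W + |κ|`. -/
theorem soloBlind_finrank_sup_span_add_le (W : Submodule K G) [FiniteDimensional K W] (y : κ → G)
    (P : Finset (Finset κ)) (C₀ : Finset κ)
    (hP : ∀ C ∈ P, ∑ x ∈ C, y x - ∑ x ∈ C₀, y x ∈ W) :
    finrank K ↥(W ⊔ Submodule.span K (Set.range y)) + finrank K ↥(soloBlindDiffSpace K P C₀)
      ≤ finrank K W + Fintype.card κ := by
  set Φ : (κ → K) →ₗ[K] G := Fintype.linearCombination K y with hΦ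
  set D := soloBlindDiffSpace K P C₀ with hD
  obtain ⟨E, hDE⟩ := Submodule.exists_isCompl D
  have hrange : Submodule.span K (Set.range y) = Submodule.map Φ ⊤ := by
    rw [Submodule.map_top, hΦ, Fintype.range_linearCombination]
  have hmapD : Submodule.map Φ D ≤ W := by
    rw [Submodule.map_le_iff_le_comap]
    exact soloBlind_diffSpace_le_comap W y P C₀ hP
  have hle : W ⊔ Submodule.span K (Set.range y) ≤ W ⊔ Submodule.map Φ E := by
    rw [hrange, ← hDE.sup_eq_top, Submodule.map_sup]
    exact sup_le le_sup_left (sup_le (hmapD.trans le_sup_left) le_sup_right)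
  have hdimE : finrank K D + finrank K E = Fintype.card κ := by
    rw [Submodule.finrank_add_eq_of_isCompl hDE, Module.finrank_fintype_fun_eq_card]
  have h1 : finrank K ↥(W ⊔ Submodule.span K (Set.range y)) ≤ finrank K ↥(W ⊔ Submodule.map Φ E) :=
    Submodule.finrank_mono hle
  have h2 : finrank K ↥(W ⊔ Submodule.map Φ E) ≤ finrank K W + finrank K ↥(Submodule.map Φ E) :=
    Submodule.finrank_add_le_finrank_add_finrank _ _
  have h3 : finrank K ↥(Submodule.map Φ E) ≤ finrank K E := Submodule.finrank_map_le Φ E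
  omega

/-- **Rank lemma** (finset form used for the core of a target): if `s` is a finite set of vectors
(the visible block elements) and all representation differences of the letters `y` over the family `P`
lie in `span s`, then `finrank (span (s ∪ range y)) + finrank D ≤ |s| + |κ|`. -/
theorem soloBlind_finrank_span_union_add_le (s : Finset G) (y : κ → G)
    (P : Finset (Finset κ)) (C₀ : Finset κ)
    (hP : ∀ C ∈ P, ∑ x ∈ C, y x - ∑ x ∈ C₀, y x ∈ Submodule.span K (s : Set G)) :
    finrank K ↥(Submodule.span K ((s : Set G) ∪ Set.range y))
        + finrank K ↥(soloBlindDiffSpace K P C₀)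
      ≤ s.card + Fintype.card κ := by
  have h := soloBlind_finrank_sup_span_add_le (Submodule.span K (s : Set G)) y P C₀ hP
  rw [Submodule.span_union]
  have hs : finrank K ↥(Submodule.span K (s : Set G)) ≤ s.card := finrank_span_finset_le_card s
  omega


/-! ## Application: the core rank of a target in block/letter position -/

section CoreRank

variable {ι : Type*} [DecidableEq ι] {G₃ : Type*} [AddCommGroup G₃] [DecidableEq G₃] [Module (ZMod 3) G₃]

/-- The letter part of a set `T ⊆ ι`, read through the letter embedding `x : κ ↪ ι`:
the set of letter indices `k` with `x k ∈ T`. -/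
def soloBlindLetterPart (x : κ ↪ ι) (T : Finset ι) : Finset κ :=
  Finset.univ.filter (fun k => x k ∈ T)

omit [DecidableEq κ] in
/-- If `T ⊆ B ∪ x(κ)` and no letter lies in `B`, the letter part of `T` maps onto `T \ B`. -/
theorem soloBlind_map_letterPart {B : Finset ι} {x : κ ↪ ι} (hBx : ∀ k, x k ∉ B) {T : Finset ι}
    (hT : T ⊆ B ∪ Finset.univ.map x) : (soloBlindLetterPart x T).map x = T \ B := by
  ext i
  simp only [soloBlindLetterPart, Finset.mem_map, Finset.mem_filter, Finset.mem_univ, true_and,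
    Finset.mem_sdiff]
  constructor
  · rintro ⟨k, hk, rfl⟩
    exact ⟨hk, hBx k⟩
  · rintro ⟨hiT, hiB⟩
    have hi := hT hiT
    rw [Finset.mem_union] at hi
    rcases hi with hi | hi
    · exact absurd hi hiB
    · rw [Finset.mem_map] at hi
      obtain ⟨k, -, rfl⟩ := hi
      exact ⟨k, hiT, rfl⟩

omit [DecidableEq κ] [DecidableEq G₃] [Module (ZMod 3) G₃] in
/-- Block/letter splitting of a subset sum: `∑_{T} h = ∑_{T ∩ B} h + ∑_{k ∈ letterPart T} h (x k)`. -/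
theorem soloBlind_sum_block_add_letter (h : ι → G₃) {B : Finset ι} {x : κ ↪ ι} (hBx : ∀ k, x k ∉ B)
    {T : Finset ι} (hT : T ⊆ B ∪ Finset.univ.map x) :
    ∑ i ∈ T, h i = ∑ i ∈ T ∩ B, h i + ∑ k ∈ soloBlindLetterPart x T, h (x k) := by
  have h1 : ∑ k ∈ soloBlindLetterPart x T, h (x k) = ∑ i ∈ T \ B, h i := by
    rw [← soloBlind_map_letterPart hBx hT, Finset.sum_map]
  rw [h1, ← Finset.sum_filter_add_sum_filter_not T (fun i => i ∈ B), Finset.filter_mem_eq_inter,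
    Finset.sdiff_eq_filter]

/-- **Core rank bound.**  Let `S ⊆ B ∪ x(κ)` with the letters `x` outside `B`, and let `T₀` represent
`τ`.  With `P` the family of letter parts of the representations of `τ` and `D` its difference space
relative to the letter part of `T₀`,
`rank (core) + dim D ≤ |core ∩ B| + |κ|`:
the representation differences of the letters are differences of block parts of representations, which
lie in the span of the block elements of the core. -/
theorem soloBlind_coreRank_add_finrank_le (h : ι → G₃) {B S : Finset ι} {x : κ ↪ ι}
    (hBx : ∀ k, x k ∉ B) (hS : S ⊆ B ∪ Finset.univ.map x) (τ : G₃) {T₀ : Finset ι}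
    (hT₀ : T₀ ∈ soloBlindSeqRepAll h S τ) :
    soloBlindCoreRank h S τ
        + finrank (ZMod 3) ↥(soloBlindDiffSpace (ZMod 3)
            ((soloBlindSeqRepAll h S τ).image (soloBlindLetterPart x)) (soloBlindLetterPart x T₀))
      ≤ (soloBlindCore h S τ ∩ B).card + Fintype.card κ := by
  classical
  set V : Finset ι := soloBlindCore h S τ ∩ B with hV
  -- representations: subset of `S` summing to `τ`
  have hrep : ∀ T ∈ soloBlindSeqRepAll h S τ, T ⊆ S ∧ ∑ i ∈ T, h i = τ := by
    intro T hT
    unfold soloBlindSeqRepAll at hT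
    rw [Finset.mem_filter, Finset.mem_powerset] at hT
    exact hT
  -- the block part of a representation lies in `V`, hence its sum in `span (h '' V)`
  have hblock : ∀ T ∈ soloBlindSeqRepAll h S τ,
      ∑ i ∈ T ∩ B, h i ∈ Submodule.span (ZMod 3) ((V.image h : Finset G₃) : Set G₃) := by
    intro T hT
    apply Submodule.sum_mem
    intro i hi
    apply Submodule.subset_span
    rw [Finset.coe_image]
    refine ⟨i, ?_, rfl⟩
    rw [Finset.mem_inter] at hi
    simp only [hV, Finset.mem_coe, Finset.mem_inter]
    exact ⟨soloBlind_mem_core.2 ⟨T, hT, hi.1⟩, hi.2⟩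
  have hP : ∀ C ∈ (soloBlindSeqRepAll h S τ).image (soloBlindLetterPart x),
      ∑ k ∈ C, (h ∘ x) k - ∑ k ∈ soloBlindLetterPart x T₀, (h ∘ x) k
        ∈ Submodule.span (ZMod 3) ((V.image h : Finset G₃) : Set G₃) := by
    intro C hC
    rw [Finset.mem_image] at hC
    obtain ⟨T, hT, rfl⟩ := hC
    have eT := soloBlind_sum_block_add_letter h hBx ((hrep T hT).1.trans hS)
    have e0 := soloBlind_sum_block_add_letter h hBx ((hrep T₀ hT₀).1.trans hS)
    rw [(hrep T hT).2] at eT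
    rw [(hrep T₀ hT₀).2] at e0
    have key : ∑ k ∈ soloBlindLetterPart x T, (h ∘ x) k - ∑ k ∈ soloBlindLetterPart x T₀, (h ∘ x) k
        = ∑ i ∈ T₀ ∩ B, h i - ∑ i ∈ T ∩ B, h i := by
      simp only [Function.comp]
      rw [sub_eq_sub_iff_add_eq_add]
      calc ∑ k ∈ soloBlindLetterPart x T, h (x k) + ∑ i ∈ T ∩ B, h i
          = τ := by rw [add_comm, ← eT]
        _ = ∑ i ∈ T₀ ∩ B, h i + ∑ k ∈ soloBlindLetterPart x T₀, h (x k) := e0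
    rw [key]
    exact Submodule.sub_mem _ (hblock T₀ hT₀) (hblock T hT)
  have main := soloBlind_finrank_span_union_add_le (V.image h) (h ∘ x)
    ((soloBlindSeqRepAll h S τ).image (soloBlindLetterPart x)) (soloBlindLetterPart x T₀) hP
  -- the core is contained in `V ∪ x(letter parts)`, so its span is contained in the span above
  have hsub : (h '' (soloBlindCore h S τ : Set ι)) ⊆ ((V.image h : Finset G₃) : Set G₃) ∪ Set.range (h ∘ x) := by
    rintro g ⟨i, hi, rfl⟩
    rw [Finset.mem_coe] at hi
    by_cases hiB : i ∈ B
    · left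
      rw [Finset.coe_image]
      exact ⟨i, by simp only [hV, Finset.mem_coe, Finset.mem_inter]; exact ⟨hi, hiB⟩, rfl⟩
    · right
      have hiS : i ∈ S := soloBlind_core_subset h S τ hi
      have hi' := hS hiS
      rw [Finset.mem_union] at hi'
      rcases hi' with hi' | hi'
      · exact absurd hi' hiB
      · rw [Finset.mem_map] at hi'
        obtain ⟨k, -, rfl⟩ := hi'
        exact ⟨k, rfl⟩
  have hfinite : ((((V.image h : Finset G₃) : Set G₃) ∪ Set.range (h ∘ x))).Finite :=
    (Finset.finite_toSet _).union (Set.finite_range _)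
  haveI := FiniteDimensional.span_of_finite (ZMod 3) hfinite
  have hfin : finrank (ZMod 3) ↥(Submodule.span (ZMod 3) (h '' (soloBlindCore h S τ : Set ι)))
      ≤ finrank (ZMod 3) ↥(Submodule.span (ZMod 3)
          (((V.image h : Finset G₃) : Set G₃) ∪ Set.range (h ∘ x))) := by
    apply Submodule.finrank_mono (Submodule.span_mono hsub)
  have hcard : (V.image h).card ≤ V.card := Finset.card_image_le
  unfold soloBlindCoreRank
  omega

end CoreRank

end Summit.MatrixMultiplication.MatrixMultiplication.Theorems
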